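import Mathlib.Analysis.InnerProductSpace.PiL2
import Mathlib.Analysis.Calculus.BumpFunction.FiniteDimension
import Mathlib.Geometry.Manifold.PartitionOfUnity
import Mathlib.Algebra.Order.Floor.Defs
import HarnessLib

/-!
# Lattice patch families in a Euclidean space: cover, bounded multiplicity, partition of unity
# (topic `Analysis/PDE`)

Geometric infrastructure for the fine level of the parametrix in the programme to prove
short-time existence for quasilinear strictly parabolic systems on a closed manifold
(hypothesis `hQL` of `Literature.Geometry.Riemannian.ricciFlow_shortTime_existence_of_quasilinear`).
In a finite-dimensional real inner product space `E'` (frame `b = stdOrthonormalBasis`,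
`n = finrank`) and for a mesh `δ > 0`:

* `latticePoint δ k = Σᵢ (kᵢ δ) • bᵢ` (`k : Fin n → ℤ`), `inner_latticePoint`;
* `exists_latticePoint_dist_le` — every point is within `√n δ` of a lattice point (floor of the
  coordinates);
* `card_le_of_dist_latticePoint_le` — **bounded multiplicity**: a finite set of lattice indices
  all of whose points lie within `R` of a given point has at most `(2R/δ + 1)ⁿ` elements;
* `latticeIndex δ R'` — the finite set of indices with lattice point in `closedBall 0 R'`,
  `mem_latticeIndex`;
* `FlatPatches` — a finite family of centres with a common radius `r`, a smooth partition of
  unity `ρ` (`0 ≤ ρ ≤ 1`, `tsupport ρᵢ ⊆ ball cᵢ (2r)`, `Σ ρ = 1` on a region) and a mesh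
  controlling the number of centres within any distance of any point (`card_le`);
  `exists_flatPatches` — from the lattice and Mathlib's smooth partitions of unity: radius
  `√n δ`, mesh `δ`, region `closedBall 0 R`.

Everything is proved; no named fact and no `sorry` is introduced.

## References

* L. Hörmander, *The Analysis of Linear Partial Differential Operators I*, Springer 1983,
  Thm. 1.4.6 (partitions of unity with bounded overlap). [folklore]
-/

noncomputable section

open Set Function Metric Filter Topology
open scoped Manifold ContDiff Topology RealInnerProductSpace

namespace Literature.Analysis.PDE

variable {E' : Type*} [NormedAddCommGroup E'] [InnerProductSpace ℝ E'] [FiniteDimensional ℝ E']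

/-! ### The lattice -/

/-- **Lattice points** of mesh `δ` along the standard frame: `Σᵢ (kᵢ δ) • bᵢ`. [folklore] -/
def latticePoint (δ : ℝ) (k : Fin (Module.finrank ℝ E') → ℤ) : E' :=
  ∑ i, ((k i : ℝ) * δ) • stdOrthonormalBasis ℝ E' i

/-- The frame coordinates of a lattice point: `⟪bᵢ, Λ k⟫ = kᵢ δ`. [folklore] -/
theorem inner_latticePoint (δ : ℝ) (k : Fin (Module.finrank ℝ E') → ℤ) (i : Fin (Module.finrank ℝ E')) :
    ⟪stdOrthonormalBasis ℝ E' i, latticePoint δ k⟫ = (k i : ℝ) * δ := by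
  rw [latticePoint, inner_sum]
  simp_rw [inner_smul_right]
  rw [Finset.sum_eq_single i]
  · simp [(stdOrthonormalBasis ℝ E').orthonormal.1 i]
  · intro j _ hji
    rw [(stdOrthonormalBasis ℝ E').orthonormal.inner_eq_zero (Ne.symm hji), mul_zero]
  · simp

/-- A coordinate is bounded by the norm: `|⟪bᵢ, x⟫| ≤ ‖x‖`. [folklore] -/
theorem abs_inner_stdOrthonormalBasis_le (x : E') (i : Fin (Module.finrank ℝ E')) :
    |⟪stdOrthonormalBasis ℝ E' i, x⟫| ≤ ‖x‖ := by
  refine (abs_real_inner_le_norm _ _).trans ?_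
  rw [(stdOrthonormalBasis ℝ E').orthonormal.1 i, one_mul]

/-- **Every point is within `√n δ` of a lattice point** (floor of the coordinates). [folklore] -/
theorem exists_latticePoint_dist_le {δ : ℝ} (hδ : 0 < δ) (x : E') :
    ∃ k : Fin (Module.finrank ℝ E') → ℤ,
      dist x (latticePoint δ k) ≤ Real.sqrt (Module.finrank ℝ E') * δ := by
  set b := stdOrthonormalBasis ℝ E'
  refine ⟨fun i ↦ ⌊⟪b i, x⟫ / δ⌋, ?_⟩
  set k : Fin (Module.finrank ℝ E') → ℤ := fun i ↦ ⌊⟪b i, x⟫ / δ⌋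
  have hcoord : ∀ i, 0 ≤ ⟪b i, x - latticePoint δ k⟫ ∧ ⟪b i, x - latticePoint δ k⟫ < δ := by
    intro i
    rw [inner_sub_right, inner_latticePoint]
    have h1 := Int.floor_le (⟪b i, x⟫ / δ)
    have h2 := Int.lt_floor_add_one (⟪b i, x⟫ / δ)
    constructor
    · have : (⌊⟪b i, x⟫ / δ⌋ : ℝ) * δ ≤ ⟪b i, x⟫ := by
        calc (⌊⟪b i, x⟫ / δ⌋ : ℝ) * δ ≤ ⟪b i, x⟫ / δ * δ := mul_le_mul_of_nonneg_right h1 hδ.le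
          _ = ⟪b i, x⟫ := div_mul_cancel₀ _ hδ.ne'
      linarith
    · have : ⟪b i, x⟫ < ((⌊⟪b i, x⟫ / δ⌋ : ℝ) + 1) * δ := by
        calc ⟪b i, x⟫ = ⟪b i, x⟫ / δ * δ := (div_mul_cancel₀ _ hδ.ne').symm
          _ < ((⌊⟪b i, x⟫ / δ⌋ : ℝ) + 1) * δ := mul_lt_mul_of_pos_right h2 hδ
      linarith
  have hsq : ‖x - latticePoint δ k‖ ^ 2 ≤ (Module.finrank ℝ E' : ℝ) * δ ^ 2 := by
    rw [← b.sum_sq_inner_right]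
    calc ∑ i, ⟪b i, x - latticePoint δ k⟫ ^ 2 ≤ ∑ _i : Fin (Module.finrank ℝ E'), δ ^ 2 := by
          refine Finset.sum_le_sum fun i _ ↦ ?_
          obtain ⟨h0, h1⟩ := hcoord i
          nlinarith
      _ = (Module.finrank ℝ E' : ℝ) * δ ^ 2 := by simp
  rw [dist_eq_norm]
  have h0 : 0 ≤ Real.sqrt (Module.finrank ℝ E') * δ := by positivity
  refine (pow_le_pow_iff_left₀ (norm_nonneg _) h0 two_ne_zero).1 ?_
  rw [mul_pow, Real.sq_sqrt (Nat.cast_nonneg _)]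
  exact hsq

/-- **Bounded multiplicity of the lattice**: a finite set of indices whose lattice points all lie
within distance `R` of a point has at most `(2R/δ + 1)ⁿ` elements (each coordinate ranges over an
integer interval of length `2R/δ`). [folklore] -/
theorem card_le_of_dist_latticePoint_le {δ : ℝ} (hδ : 0 < δ) {R : ℝ} (hR : 0 ≤ R) (x : E')
    {T : Finset (Fin (Module.finrank ℝ E') → ℤ)} (hT : ∀ k ∈ T, dist x (latticePoint δ k) ≤ R) :
    (T.card : ℝ) ≤ (2 * R / δ + 1) ^ Module.finrank ℝ E' := by
  classical
  set b := stdOrthonormalBasis ℝ E'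
  -- the integer box containing `T`
  set lo : Fin (Module.finrank ℝ E') → ℤ := fun i ↦ ⌈(⟪b i, x⟫ - R) / δ⌉
  set hi : Fin (Module.finrank ℝ E') → ℤ := fun i ↦ ⌊(⟪b i, x⟫ + R) / δ⌋
  have hsub : T ⊆ Fintype.piFinset fun i ↦ Finset.Icc (lo i) (hi i) := by
    intro k hk
    rw [Fintype.mem_piFinset]
    intro i
    rw [Finset.mem_Icc]
    have hd := hT k hk
    have hci : |⟪b i, x⟫ - (k i : ℝ) * δ| ≤ R := by
      rw [← inner_latticePoint δ k i, ← inner_sub_right]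
      exact (abs_inner_stdOrthonormalBasis_le _ i).trans (by rwa [dist_eq_norm] at hd)
    obtain ⟨h1, h2⟩ := abs_le.1 hci
    constructor
    · refine Int.ceil_le.2 ?_
      rw [div_le_iff₀ hδ]
      linarith
    · refine Int.le_floor.2 ?_
      rw [le_div_iff₀ hδ]
      linarith
  have hcard := Finset.card_le_card hsub
  rw [Fintype.card_piFinset] at hcard
  calc (T.card : ℝ) ≤ ((∏ i, (Finset.Icc (lo i) (hi i)).card : ℕ) : ℝ) := by exact_mod_cast hcard
    _ = ∏ i, ((Finset.Icc (lo i) (hi i)).card : ℝ) := by push_cast; rfl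
    _ ≤ ∏ _i : Fin (Module.finrank ℝ E'), (2 * R / δ + 1) := by
        refine Finset.prod_le_prod (fun i _ ↦ Nat.cast_nonneg _) fun i _ ↦ ?_
        rw [Int.card_Icc]
        have h1 : ((hi i + 1 - lo i).toNat : ℝ) ≤ max ((hi i : ℝ) + 1 - lo i) 0 := by
          have e : (((hi i + 1 - lo i).toNat : ℤ) : ℝ) = ((max (hi i + 1 - lo i) 0 : ℤ) : ℝ) := by
            rw [Int.toNat_eq_max]
          rw [Int.cast_natCast] at e
          rw [e]
          push_cast
          exact le_rfl
        refine h1.trans (max_le ?_ (by positivity))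
        have hhi : (hi i : ℝ) ≤ (⟪b i, x⟫ + R) / δ := Int.floor_le _
        have hlo : (⟪b i, x⟫ - R) / δ ≤ lo i := Int.le_ceil _
        have : (⟪b i, x⟫ + R) / δ - (⟪b i, x⟫ - R) / δ = 2 * R / δ := by ring
        linarith
    _ = (2 * R / δ + 1) ^ Module.finrank ℝ E' := by simp

/-- **The finite set of lattice indices with point in a ball.** [folklore] -/
def latticeIndex (δ R' : ℝ) : Finset (Fin (Module.finrank ℝ E') → ℤ) :=
  (Fintype.piFinset fun _ ↦ Finset.Icc (-⌈R' / δ⌉) ⌈R' / δ⌉).filter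
    fun k ↦ ‖(latticePoint δ k : E')‖ ≤ R'

/-- Membership in `latticeIndex`: exactly the indices with `‖Λ k‖ ≤ R'`. [folklore] -/
theorem mem_latticeIndex {δ : ℝ} (hδ : 0 < δ) {R' : ℝ} {k : Fin (Module.finrank ℝ E') → ℤ} :
    k ∈ (latticeIndex δ R' : Finset (Fin (Module.finrank ℝ E') → ℤ)) ↔ ‖(latticePoint δ k : E')‖ ≤ R' := by
  rw [latticeIndex, Finset.mem_filter]
  constructor
  · exact fun h ↦ h.2
  · intro h
    refine ⟨?_, h⟩
    rw [Fintype.mem_piFinset]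
    intro i
    rw [Finset.mem_Icc]
    have hci : |(k i : ℝ) * δ| ≤ R' := by
      rw [← inner_latticePoint δ k i]
      exact (abs_inner_stdOrthonormalBasis_le _ i).trans h
    rw [abs_mul, abs_of_pos hδ] at hci
    have h1 : |(k i : ℝ)| ≤ R' / δ := by rwa [le_div_iff₀ hδ]
    obtain ⟨h2, h3⟩ := abs_le.1 h1
    have hc : R' / δ ≤ (⌈R' / δ⌉ : ℝ) := Int.le_ceil _
    constructor
    · have : ((-⌈R' / δ⌉ : ℤ) : ℝ) ≤ (k i : ℝ) := by push_cast; linarith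
      exact_mod_cast this
    · have : (k i : ℝ) ≤ ((⌈R' / δ⌉ : ℤ) : ℝ) := h3.trans hc
      exact_mod_cast this

/-! ### Flat patch families -/

/-- **A flat patch family**: finitely many centres with a common radius, a smooth partition of
unity subordinate to the balls of radius `2r` summing to `1` on `region`, and a mesh bounding the
number of centres within any distance of any point. [folklore] -/
structure FlatPatches (E' : Type*) [NormedAddCommGroup E'] [InnerProductSpace ℝ E'] (ι : Type*)
    [Fintype ι] where
  /-- the centres -/
  c : ι → E'
  /-- the common radius -/
  r : ℝ
  r_pos : 0 < r
  /-- the partition functions -/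
  ρ : ι → E' → ℝ
  ρ_smooth : ∀ i, ContDiff ℝ ∞ (ρ i)
  ρ_nonneg : ∀ i x, 0 ≤ ρ i x
  ρ_le_one : ∀ i x, ρ i x ≤ 1
  tsupport_ρ : ∀ i, tsupport (ρ i) ⊆ ball (c i) (2 * r)
  /-- the region where the partition sums to one -/
  region : Set E'
  sum_ρ : ∀ x ∈ region, ∑ i, ρ i x = 1
  /-- the mesh controlling the multiplicity counts -/
  mesh : ℝ
  mesh_pos : 0 < mesh
  /-- bounded multiplicity at every scale: the centres within `R'` of any point are at most
  `(2R'/mesh + 1)ⁿ` -/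
  card_le : ∀ (x : E') (R' : ℝ), 0 ≤ R' → ∀ T : Finset ι, (∀ i ∈ T, dist x (c i) ≤ R') →
    (T.card : ℝ) ≤ (2 * R' / mesh + 1) ^ Module.finrank ℝ E'

namespace FlatPatches

variable {ι : Type*} [Fintype ι] (Q : FlatPatches E' ι)

/-- The inner cut-off of patch `i`: `1` on `closedBall cᵢ (2r) ⊇ tsupport ρᵢ`, supported in
`closedBall cᵢ (3r)`. [folklore] -/
def cut (i : ι) : ContDiffBump (Q.c i) := ⟨2 * Q.r, 3 * Q.r, by linarith [Q.r_pos], by linarith [Q.r_pos]⟩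

/-- The outer cut-off of patch `i`: `1` on `closedBall cᵢ (3r) ⊇ tsupport cutᵢ`, supported in
`closedBall cᵢ (4r)`. [folklore] -/
def cutPlus (i : ι) : ContDiffBump (Q.c i) :=
  ⟨3 * Q.r, 4 * Q.r, by linarith [Q.r_pos], by linarith [Q.r_pos]⟩

omit [FiniteDimensional ℝ E'] in
/-- `cut_rIn`: cut rIn. [folklore] -/
@[simp] theorem cut_rIn (i : ι) : (Q.cut i).rIn = 2 * Q.r := rfl
omit [FiniteDimensional ℝ E'] in
/-- `cut_rOut`: cut rOut. [folklore] -/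
@[simp] theorem cut_rOut (i : ι) : (Q.cut i).rOut = 3 * Q.r := rfl
omit [FiniteDimensional ℝ E'] in
/-- `cutPlus_rIn`: cutPlus rIn. [folklore] -/
@[simp] theorem cutPlus_rIn (i : ι) : (Q.cutPlus i).rIn = 3 * Q.r := rfl
omit [FiniteDimensional ℝ E'] in
/-- `cutPlus_rOut`: cutPlus rOut. [folklore] -/
@[simp] theorem cutPlus_rOut (i : ι) : (Q.cutPlus i).rOut = 4 * Q.r := rfl

/-- `cut = 1` on the support of `ρ`. [folklore] -/
theorem cut_eq_one_of_mem_tsupport_ρ (i : ι) {x : E'} (hx : x ∈ tsupport (Q.ρ i)) : Q.cut i x = 1 :=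
  (Q.cut i).one_of_mem_closedBall (by
    rw [cut_rIn]; exact ball_subset_closedBall (Q.tsupport_ρ i hx))

/-- `cutPlus = 1` on the support of `cut`. [folklore] -/
theorem cutPlus_eq_one_of_mem_tsupport_cut (i : ι) {x : E'} (hx : x ∈ tsupport (Q.cut i)) :
    Q.cutPlus i x = 1 :=
  (Q.cutPlus i).one_of_mem_closedBall (by
    rw [cutPlus_rIn, ← Q.cut_rOut i, ← (Q.cut i).tsupport_eq]; exact hx)

/-- The supports of the cut-offs lie in `closedBall cᵢ (4r)`. [folklore] -/
theorem tsupport_cutPlus_subset (i : ι) : tsupport (Q.cutPlus i) ⊆ closedBall (Q.c i) (4 * Q.r) := by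
  rw [(Q.cutPlus i).tsupport_eq, cutPlus_rOut]

/-- **Bounded overlap**: at every point at most `(8r/mesh + 1)ⁿ` of the functions `cutPlus i`
(hence `cut i`, `ρ i`) are non-zero. [folklore] -/
theorem card_cutPlus_ne_zero_le (x : E') (T : Finset ι) (hT : ∀ i ∈ T, Q.cutPlus i x ≠ 0) :
    (T.card : ℝ) ≤ (2 * (4 * Q.r) / Q.mesh + 1) ^ Module.finrank ℝ E' :=
  Q.card_le x (4 * Q.r) (by linarith [Q.r_pos]) T fun i hi ↦
    mem_closedBall'.1 (Q.tsupport_cutPlus_subset i (subset_tsupport _ (hT i hi))) |> fun h ↦ by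
      rwa [dist_comm] at h

omit [FiniteDimensional ℝ E'] in
/-- **Bounded number of neighbours**: the centres within `R'` of a centre are at most
`(2R'/mesh + 1)ⁿ`. [folklore] -/
theorem card_neighbours_le (j : ι) {R' : ℝ} (hR' : 0 ≤ R') (T : Finset ι) (hT : ∀ i ∈ T, dist (Q.c j) (Q.c i) ≤ R') :
    (T.card : ℝ) ≤ (2 * R' / Q.mesh + 1) ^ Module.finrank ℝ E' :=
  Q.card_le (Q.c j) R' hR' T hT

end FlatPatches

/-! ### Existence from the lattice -/

/-- **Lattice patch families exist**: for every mesh `δ > 0` and radius `R`, there is a flat patch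
family with centres at lattice points, common radius `√n δ` (`n = finrank`, `n ≥ 1`), partition of
unity summing to `1` on `closedBall 0 R`. [folklore] -/
theorem exists_flatPatches [Nontrivial E'] {δ : ℝ} (hδ : 0 < δ) (R : ℝ) :
    ∃ (ι : Type) (_ : Fintype ι) (Q : FlatPatches E' ι),
      Q.r = Real.sqrt (Module.finrank ℝ E') * δ ∧ Q.mesh = δ ∧ closedBall (0 : E') R ⊆ Q.region ∧
      ∀ i, ∃ k, Q.c i = latticePoint δ k := by
  classical
  set n := Module.finrank ℝ E'
  have hn : 0 < (n : ℝ) := by exact_mod_cast Module.finrank_pos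
  set r : ℝ := Real.sqrt n * δ with hr
  have hr0 : 0 < r := mul_pos (Real.sqrt_pos.2 hn) hδ
  -- the index type: lattice points in `closedBall 0 (R + r)`
  set L := (latticeIndex δ (R + r) : Finset (Fin n → ℤ))
  set ι := ↥L
  -- the partition of unity on the model space, subordinate to the balls of radius `2r`
  have hcov : closedBall (0 : E') R ⊆ ⋃ i : ι, ball (latticePoint δ (i : Fin n → ℤ)) (2 * r) := by
    intro x hx
    obtain ⟨k, hk⟩ := exists_latticePoint_dist_le hδ x
    have hkL : k ∈ L := by
      rw [mem_latticeIndex hδ]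
      calc ‖latticePoint δ k‖ = dist (latticePoint δ k) 0 := (dist_zero_right _).symm
        _ ≤ dist (latticePoint δ k) x + dist x 0 := dist_triangle _ _ _
        _ ≤ r + R := add_le_add (by rwa [dist_comm]) (mem_closedBall.1 hx)
        _ = R + r := add_comm _ _
    refine mem_iUnion.2 ⟨⟨k, hkL⟩, ?_⟩
    rw [mem_ball]
    linarith
  obtain ⟨f, hf⟩ := SmoothPartitionOfUnity.exists_isSubordinate (I := 𝓘(ℝ, E')) (M := E')
    isClosed_closedBall (fun i : ι ↦ ball (latticePoint δ (i : Fin n → ℤ)) (2 * r))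
    (fun _ ↦ isOpen_ball) hcov
  refine ⟨ι, inferInstance,
    { c := fun i ↦ latticePoint δ (i : Fin n → ℤ)
      r := r
      r_pos := hr0
      ρ := fun i ↦ f i
      ρ_smooth := fun i ↦ contMDiff_iff_contDiff.1 (f i).contMDiff
      ρ_nonneg := fun i x ↦ f.nonneg i x
      ρ_le_one := fun i x ↦ f.le_one i x
      tsupport_ρ := fun i ↦ hf i
      region := closedBall 0 R
      sum_ρ := fun x hx ↦ by rw [← finsum_eq_sum_of_fintype]; exact f.sum_eq_one hx
      mesh := δ
      mesh_pos := hδ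
      card_le := fun x R' hR' T hT ↦ ?_ }, rfl, rfl, Subset.rfl, fun i ↦ ⟨i, rfl⟩⟩
  -- the indices inject into lattice indices within `R'` of `x`
  set T' : Finset (Fin n → ℤ) := T.image fun i : ι ↦ (i : Fin n → ℤ)
  have hTc : T.card = T'.card := (Finset.card_image_of_injective _ Subtype.val_injective).symm
  have hT' : ∀ k ∈ T', dist x (latticePoint δ k) ≤ R' := by
    intro k hk
    obtain ⟨i, hi, rfl⟩ := Finset.mem_image.1 hk
    exact hT i hi
  have hb := card_le_of_dist_latticePoint_le hδ hR' x hT'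
  rw [hTc]
  exact hb

end Literature.Analysis.PDE

end
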